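import Literature.Probability.RandomPlanarGeometry.CritPercSLESpaceFilling
import Literature.Probability.RandomPlanarGeometry.SLEDerivRatioMartingaleProofs
import Literature.Probability.RandomPlanarGeometry.RohdeSchrammCor35Proofs
import HarnessLib

/-!
# The per-point density fact `ae_infDist_sleTrace_eq_zero_of_eight_le`: what it amounts to

Topic `Probability/RandomPlanarGeometry`; theorems only, nothing is redefined and no named fact is
introduced. Bookkeeping on the named fact
`Literature.Probability.RandomPlanarGeometry.ae_infDist_sleTrace_eq_zero_of_eight_le` of
`CritPercSLESpaceFilling.lean` (S. Rohde, O. Schramm, *Basic properties of SLE*, Ann. of Math. 161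
(2005), Lemma 6.3 with eq. (6.2), pp. 903–904 = arXiv pp. 13: "Let `κ > 0` and `z = x + iy ∈ ℍ`.
Then the limit `Z(z) := lim_{t ↑ τ(z)} y |gₜ'(z)| / Im gₜ(z)` exists a.s. We have `Z(z) = ∞` a.s.
if `κ ≥ 8`", and (6.2) `Z(z₀)⁻¹ Im z₀ / 2 ≤ dist(z₀, γ[0, ∞) ∪ ℝ) ≤ 2 Z(z₀)⁻¹ Im z₀`, obtained
from `rₜ |gₜ'(z₀)| ≤ 2 Im gₜ(z₀)` (Schwarz), `Im gₜ(z₀) ≤ 2 rₜ |gₜ'(z₀)|` (Koebe) and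
`lim_{t ↑ τ(z₀)} rₜ = dist(z₀, γ[0, ∞) ∪ ℝ)`, `rₜ = dist(z₀, ∂Hₜ)`).

The probabilistic content (Lemma 6.3 for `κ ≥ 8`) and the Schwarz half of (6.2) are PROVED in the
tree (`tendsto_sleDerivRatio_atTop_of_eight_le_holds`,
`Loewner.infDist_compl_domain_mul_norm_deriv_map_le`). What they give *without any input on the
existence of the trace* is the trace-free form of the density statement, proved here:

* `ae_forall_exists_infDist_compl_domain_lt_of_eight_le`: for `κ ≥ 8` and `z ∈ ℍ`, almost surely
  `inf_{t < τ(z)} rₜ = 0`, i.e. the hulls `Kₜ ∪ ℝ` come arbitrarily close to `z` before `τ(z)`.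

The named fact itself speaks of `range (sleTrace κ ω)`, and `sleTrace κ ω` is the documented junk
constant path `0` when the chain of `√κ B(ω)` is not generated by a curve; at such an `ω` the
distance in the fact is `Im z > 0`. Hence, over the proved tree, the fact is **equivalent** to the
existence of the trace for every `κ ≥ 8`:

* `hasSLETrace_of_ae_infDist_sleTrace_eq_zero`: a.s. `dist(z, γ[0,∞) ∪ ℝ) = 0` at one `z ∈ ℍ`
  already forces `HasSLETrace κ`;
* `ae_infDist_sleTrace_eq_zero_of_eight_le_iff_forall_hasSLETrace`:
  `ae_infDist_sleTrace_eq_zero_of_eight_le ↔ ∀ κ ≥ 8, HasSLETrace κ`;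
* `ae_infDist_sleTrace_eq_zero_of_eight_le_of_hasSLETrace_eight_of_gt`: the fact from SLE₈ being
  generated by a curve (`hasSLETrace_eight`, Lawler–Schramm–Werner (2004), Thm 4.7) and
  `HasSLETrace κ` for `κ > 8` (the `κ > 8` slice of `hasSLETrace_of_ne_eight`, Rohde–Schramm (2005),
  Thm 5.1) — these two trace theorems are exactly the remaining inputs, and conversely the fact
  returns both of them (`hasSLETrace_eight_of_ae_infDist_sleTrace_eq_zero_of_eight_le`,
  `hasSLETrace_of_eight_lt_of_ae_infDist_sleTrace_eq_zero_of_eight_le`).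

This matches the source: on arXiv p. 13 Rohde–Schramm note "(For `κ = 8` we have not proven that
`γ` is a path. In that case, `γ[0, ∞)` is defined as the union over `t` of all limit points of
sequences `g_t⁻¹(z_j)` where `z_j → 0` in `ℍ`…)", i.e. the printed density statement at `κ = 8`
is about the hulls, which is the trace-free form above; the vendored fact uses the genuine trace
and therefore also carries [LSW] Thm 4.7 and RS05 Thm 5.1 (`κ > 8`).

**With Rohde–Schramm's theorem proved.** Thm 5.1 is now a theorem of the tree
(`hasSLETrace_of_ne_eight_holds`, `RohdeSchrammCor35Proofs.lean`, from the proved Cor. 3.5), so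
the `κ > 8` slice of the named fact holds outright (`ae_infDist_sleTrace_eq_zero_of_eight_lt`,
with the a.s. density `ae_subset_closure_range_sleTrace_of_eight_lt`), and the named fact is
equivalent to the single remaining input, SLE₈ being generated by a curve
(`ae_infDist_sleTrace_eq_zero_of_eight_le_iff_hasSLETrace_eight`; the discharge-to-be is
`ae_infDist_sleTrace_eq_zero_of_eight_le_of_hasSLETrace_eight`).

## References

* S. Rohde, O. Schramm, *Basic properties of SLE*, Ann. of Math. 161 (2005) 883–924
  (arXiv:math/0106036): Lemma 6.3, eq. (6.2) and the remark following it (pp. 903–904 / arXiv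
  p. 13); Thm 5.1; Cor. 7.4.
* G. F. Lawler, O. Schramm, W. Werner, *Conformal invariance of planar loop-erased random walks
  and uniform spanning trees*, Ann. Probab. 32 (2004) 939–995, Thm 4.7.
-/

noncomputable section

open Set Filter Topology MeasureTheory Metric
open UpperHalfPlane (upperHalfPlaneSet)
open scoped NNReal

namespace Literature.Probability.RandomPlanarGeometry

open Loewner

variable {κ : ℝ≥0} {z : ℂ}

/-! ### The trace-free form of Lemma 6.3 with eq. (6.2): `inf_{t < τ(z)} rₜ = 0` a.s. -/

/-- **Rohde–Schramm (2005), Lemma 6.3 with the Schwarz half of eq. (6.2), trace-free form,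
PROVED**: for `κ ≥ 8` and `z ∈ ℍ`, almost surely, for every `ε > 0` there is a time `t < τ(z)`
with `rₜ = dist(z, ∂Hₜ) = dist(z, Hₜᶜ) < ε` — from `rₜ |gₜ'(z)| ≤ 2 Im gₜ(z)` (p. 903, proved as
`Loewner.infDist_compl_domain_mul_norm_deriv_map_le`) and `(Im z) |gₜ'(z)| / Im gₜ(z) → ∞` as
`t ↑ τ(z)` (Lemma 6.3, `κ ≥ 8`, proved as `tendsto_sleDerivRatio_atTop_of_eight_le_holds`):
`rₜ ≤ 2 Im z / ψₜ → 0`. No statement about the trace is used. [cite: RohdeSchramm2005, Lemma 6.3 and eq. (6.2)] -/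
theorem ae_forall_exists_infDist_compl_domain_lt_of_eight_le (hκ : 8 ≤ κ) (hz : z ∈ upperHalfPlaneSet) :
    ∀ᵐ ω ∂Process.preWienerMeasure, ∀ ε : ℝ, 0 < ε →
      ∃ t : ℝ≥0, (t : WithTop ℝ≥0) < swallowingTime (sleDriving κ ω) z ∧
        infDist z (domain (sleDriving κ ω) t)ᶜ < ε := by
  filter_upwards [tendsto_sleDerivRatio_atTop_of_eight_le_holds hκ z hz] with ω hT
  intro ε hε
  have hW : Continuous (sleDriving κ ω) := continuous_sleDriving κ ω
  have hzim : 0 < z.im := hz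
  have hzW : z ≠ sleDriving κ ω 0 := ne_driving_of_im_pos hzim 0
  have h0 : ((0 : ℝ≥0) : WithTop ℝ≥0) < swallowingTime (sleDriving κ ω) z :=
    swallowingTime_pos_holds hW hzW
  haveI : Nonempty {t : ℝ≥0 // (t : WithTop ℝ≥0) < swallowingTime (sleDriving κ ω) z} := ⟨⟨0, h0⟩⟩
  -- pick `t < τ(z)` with `ψₜ ≥ M := 2 Im z / ε + 1`
  obtain ⟨t, ht⟩ := (hT.eventually_ge_atTop (2 * z.im / ε + 1)).exists
  refine ⟨t, t.2, ?_⟩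
  have hzdom : z ∈ domain (sleDriving κ ω) t := (mem_domain_iff _ _ _).2 ⟨hz, t.2⟩
  have him : 0 < (sleMap κ ω t z).im := mapsTo_map hW t hzdom
  have h2 : infDist z (domain (sleDriving κ ω) t)ᶜ * ‖deriv (sleMap κ ω t) z‖ ≤
      2 * (sleMap κ ω t z).im :=
    infDist_compl_domain_mul_norm_deriv_map_le hW hzdom
  have h3 : 2 * z.im / ε + 1 ≤ z.im * ‖deriv (sleMap κ ω t) z‖ / (sleMap κ ω t z).im := ht
  rw [le_div_iff₀ him] at h3
  have hMpos : 0 < 2 * z.im / ε + 1 := by positivity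
  have hD : 0 < ‖deriv (sleMap κ ω t) z‖ := by
    refine lt_of_not_ge fun hD ↦ ?_
    have : z.im * ‖deriv (sleMap κ ω t) z‖ ≤ 0 := mul_nonpos_of_nonneg_of_nonpos hzim.le hD
    nlinarith [mul_pos hMpos him]
  set r := infDist z (domain (sleDriving κ ω) t)ᶜ with hr_def
  set D := ‖deriv (sleMap κ ω t) z‖ with hD_def
  set M := 2 * z.im / ε + 1 with hM_def
  have h4 : r * D * M ≤ 2 * (z.im * D) := by
    calc r * D * M ≤ 2 * (sleMap κ ω t z).im * M := by gcongr
      _ = 2 * (M * (sleMap κ ω t z).im) := by ring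
      _ ≤ 2 * (z.im * D) := by gcongr
  have h5 : r * M ≤ 2 * z.im := le_of_mul_le_mul_right (by nlinarith [h4]) hD
  refine lt_of_not_ge fun h7 ↦ ?_
  -- `ε M ≤ r M ≤ 2 Im z`, but `ε M = 2 Im z + ε > 2 Im z`
  have : ε * M ≤ 2 * z.im := (mul_le_mul_of_nonneg_right h7 hMpos.le).trans h5
  have hεM : ε * M = 2 * z.im + ε := by rw [hM_def]; field_simp
  linarith

/-- The same in closure form: for `κ ≥ 8` and `z ∈ ℍ`, almost surely `z` lies in the closure of
the union of the SLE_κ hulls `Kₜ` over `t < τ(z)` (the distance from `z` to `ℝ` being `Im z > 0`,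
small `rₜ = dist(z, Kₜ ∪ (ℂ ∖ ℍ))` means `Kₜ` is close to `z`). This is the sense in which
"`γ[0, ∞)` is dense in `ℍ`" holds at `κ = 8` in Rohde–Schramm (2005) before [LSW]: p. 904 /
arXiv p. 13, "`γ[0, ∞)` is defined as the union over `t` of all limit points …,
`closure (⋃ₜ ∂Kₜ) = closure γ[0, ∞)`". [cite: RohdeSchramm2005, Lemma 6.3 and eq. (6.2)] -/
theorem ae_mem_closure_iUnion_sleHull_of_eight_le (hκ : 8 ≤ κ) (hz : z ∈ upperHalfPlaneSet) :
    ∀ᵐ ω ∂Process.preWienerMeasure,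
      z ∈ closure (⋃ t : {t : ℝ≥0 // (t : WithTop ℝ≥0) < swallowingTime (sleDriving κ ω) z},
        sleHull κ ω t) := by
  filter_upwards [ae_forall_exists_infDist_compl_domain_lt_of_eight_le hκ hz] with ω hω
  have hzim : 0 < z.im := hz
  rw [Metric.mem_closure_iff]
  intro ε hε
  obtain ⟨t, ht, hr⟩ := hω (min ε z.im) (lt_min hε hzim)
  -- a point of `Hₜᶜ` within `min ε (Im z)` of `z`; it is not in `ℂ ∖ ℍ`, so it is in `Kₜ`
  have hne : ((domain (sleDriving κ ω) t)ᶜ : Set ℂ).Nonempty :=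
    ⟨0, fun h0 ↦ by simpa using (show (0 : ℝ) < (0 : ℂ).im from domain_subset _ t h0)⟩
  obtain ⟨y, hy, hyd⟩ := (infDist_lt_iff hne).1 hr
  refine ⟨y, mem_iUnion.2 ⟨⟨t, ht⟩, ?_⟩, hyd.trans_le (min_le_left _ _)⟩
  -- `y ∉ Hₜ = ℍ ∖ Kₜ` and `y ∈ ℍ` (it is within `Im z` of `z`)
  have hyim : 0 < y.im := by
    have h1 : |(z - y).im| ≤ ‖z - y‖ := Complex.abs_im_le_norm (z - y)
    rw [Complex.sub_im, ← dist_eq_norm] at h1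
    have h2 := (abs_sub_lt_iff.1 (h1.trans_lt (hyd.trans_le (min_le_right _ _)))).1
    linarith
  by_contra hyK
  exact hy ⟨hyim, hyK⟩

/-! ### The fact forces, and follows from, the existence of the trace for `κ ≥ 8` -/

/-- **A.s. density at one point forces the chain to be generated by a curve.** If for some
`z ∈ ℍ` almost surely `dist(z, γ[0, ∞) ∪ ℝ) = 0` for `γ = sleTrace κ ω`, then `HasSLETrace κ`:
where the chain of `√κ B(ω)` is not generated by a curve, `sleTrace κ ω` is the junk constant path
`0`, and `dist(z, {0} ∪ ℝ) = Im z > 0`. (In Rohde–Schramm (2005) the `γ` of eq. (6.2) is the path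
of Thm 5.1, resp. of [LSW] Thm 4.7 at `κ = 8`; this records that the vendored per-point form
carries that existence statement.) [cite: RohdeSchramm2005, eq. (6.2) and Thm 5.1] -/
theorem hasSLETrace_of_ae_infDist_sleTrace_eq_zero (hz : z ∈ upperHalfPlaneSet)
    (h : ∀ᵐ ω ∂Process.preWienerMeasure,
      infDist z (range (sleTrace κ ω) ∪ {w : ℂ | w.im = 0}) = 0) :
    HasSLETrace κ := by
  filter_upwards [h] with ω hω
  by_contra hne
  have hconst : sleTrace κ ω = fun _ ↦ ((sleDriving κ ω 0 : ℝ) : ℂ) := by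
    unfold sleTrace Loewner.trace
    rw [dif_neg hne]
  have hmem : z ∈ closure (range (sleTrace κ ω)) :=
    mem_closure_of_infDist_union_eq_zero hz (range_nonempty _) hω
  rw [hconst, sleDriving_zero, Complex.ofReal_zero, range_const, closure_singleton,
    mem_singleton_iff] at hmem
  have hzim : 0 < z.im := hz
  rw [hmem, Complex.zero_im] at hzim
  exact lt_irrefl 0 hzim

/-- The named fact, granted, yields `HasSLETrace κ` for every `κ ≥ 8` (take `z = i`).
[cite: RohdeSchramm2005, eq. (6.2) and Thm 5.1] -/
theorem hasSLETrace_of_ae_infDist_sleTrace_eq_zero_of_eight_le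
    (h : ae_infDist_sleTrace_eq_zero_of_eight_le) (hκ : 8 ≤ κ) : HasSLETrace κ :=
  hasSLETrace_of_ae_infDist_sleTrace_eq_zero (z := Complex.I) (show (0 : ℝ) < Complex.I.im by simp)
    (h hκ Complex.I (show (0 : ℝ) < Complex.I.im by simp))

/-- In particular the named fact returns **SLE₈ is generated by a curve** (`hasSLETrace_eight`,
Lawler–Schramm–Werner (2004), Thm 4.7). [cite: LawlerSchrammWerner2004, Thm 4.7] -/
theorem hasSLETrace_eight_of_ae_infDist_sleTrace_eq_zero_of_eight_le
    (h : ae_infDist_sleTrace_eq_zero_of_eight_le) : hasSLETrace_eight :=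
  hasSLETrace_of_ae_infDist_sleTrace_eq_zero_of_eight_le h le_rfl

/-- … and the `κ > 8` slice of the Rohde–Schramm theorem (`hasSLETrace_of_ne_eight`, Thm 5.1).
[cite: RohdeSchramm2005, Thm 5.1] -/
theorem hasSLETrace_of_eight_lt_of_ae_infDist_sleTrace_eq_zero_of_eight_le
    (h : ae_infDist_sleTrace_eq_zero_of_eight_le) (hκ : 8 < κ) : HasSLETrace κ :=
  hasSLETrace_of_ae_infDist_sleTrace_eq_zero_of_eight_le h hκ.le

/-- **`ae_infDist_sleTrace_eq_zero_of_eight_le ↔ ∀ κ ≥ 8, HasSLETrace κ`** over the proved tree: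
`←` is Lemma 6.3 with eq. (6.2), proved per `κ` under `HasSLETrace κ`
(`ae_infDist_sleTrace_eq_zero_of_hasSLETrace`); `→` is the junk-trace observation
`hasSLETrace_of_ae_infDist_sleTrace_eq_zero`. So the inputs still missing for the named fact are
exactly RS05 Thm 5.1 for `κ > 8` and [LSW] Thm 4.7. [cite: RohdeSchramm2005, Lemma 6.3 and eq. (6.2)] -/
theorem ae_infDist_sleTrace_eq_zero_of_eight_le_iff_forall_hasSLETrace :
    ae_infDist_sleTrace_eq_zero_of_eight_le ↔ ∀ κ : ℝ≥0, 8 ≤ κ → HasSLETrace κ := by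
  refine ⟨fun h κ hκ ↦ hasSLETrace_of_ae_infDist_sleTrace_eq_zero_of_eight_le h hκ, fun h ↦ ?_⟩
  intro κ hκ z hz
  exact ae_infDist_sleTrace_eq_zero_of_hasSLETrace (h κ hκ) hκ hz

/-- **The named fact from the two remaining trace theorems**: SLE₈ generated by a curve
(`hasSLETrace_eight`, [LSW] Thm 4.7; hypothesis `h8`) and `HasSLETrace κ` for `κ > 8` (RS05
Thm 5.1; `hgt`); Lemma 6.3 and eq. (6.2) are proved. [cite: RohdeSchramm2005, Lemma 6.3 and eq. (6.2)] -/
theorem ae_infDist_sleTrace_eq_zero_of_eight_le_of_hasSLETrace_eight_of_gt (h8 : hasSLETrace_eight)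
    (hgt : ∀ κ : ℝ≥0, 8 < κ → HasSLETrace κ) : ae_infDist_sleTrace_eq_zero_of_eight_le :=
  ae_infDist_sleTrace_eq_zero_of_eight_le_iff_forall_hasSLETrace.2 fun κ hκ ↦ by
    rcases hκ.eq_or_lt with h | h
    · subst h; exact h8
    · exact hgt κ h

/-- The same with the `κ > 8` input quoted from the named fact `hasSLETrace_of_ne_eight`
(Thm 5.1 for all `κ ≠ 8`, used only for `κ > 8`); compare
`ae_infDist_sleTrace_eq_zero_of_eight_le_of_facts` (`SLETraceDensity.lean`), whose third
hypothesis (Lemma 6.3) is now a theorem. [cite: RohdeSchramm2005, Lemma 6.3 and eq. (6.2)] -/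
theorem ae_infDist_sleTrace_eq_zero_of_eight_le_of_traceFacts (h8 : hasSLETrace_eight)
    (hne : hasSLETrace_of_ne_eight) : ae_infDist_sleTrace_eq_zero_of_eight_le :=
  ae_infDist_sleTrace_eq_zero_of_eight_le_of_hasSLETrace_eight_of_gt h8 fun _ hκ ↦ hne hκ.ne'

/-! ### With Thm 5.1 proved: the `κ > 8` slice outright, and the fact `↔ hasSLETrace_eight` -/

/-- **Per-point density of the SLE_κ trace for `κ > 8`, PROVED** (Rohde–Schramm (2005),
Lemma 6.3 with eq. (6.2), pp. 903–904, in the range of Cor. 7.4 as printed): for `κ > 8` and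
`z ∈ ℍ`, almost surely `dist(z, γ[0, ∞) ∪ ℝ) = 0` — Lemma 6.3 (`Z(z) = ∞` a.s.,
`tendsto_sleDerivRatio_atTop_of_eight_le_holds`), the Schwarz half of (6.2), and the existence of
the trace `γ` by Thm 5.1 (`hasSLETrace_of_ne_eight_holds`). No input from [LSW].
[cite: RohdeSchramm2005, Lemma 6.3 and eq. (6.2)] -/
theorem ae_infDist_sleTrace_eq_zero_of_eight_lt (hκ : 8 < κ) (hz : z ∈ upperHalfPlaneSet) :
    ∀ᵐ ω ∂Process.preWienerMeasure, infDist z (range (sleTrace κ ω) ∪ {w : ℂ | w.im = 0}) = 0 :=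
  ae_infDist_sleTrace_eq_zero_of_hasSLETrace (hasSLETrace_of_ne_eight_holds hκ.ne') hκ.le hz

/-- **The SLE_κ trace is almost surely dense in `H̄` for `κ > 8`, PROVED** ("from Lemma 6.3 and
(6.2) we know that `γ[0, ∞)` is a.s. dense in `H̄`", Rohde–Schramm (2005), proof of Cor. 7.4,
p. 911, for `κ > 8`): almost surely `ℍ ⊆ closure γ[0, ∞)`.
[cite: RohdeSchramm2005, proof of Cor. 7.4] -/
theorem ae_subset_closure_range_sleTrace_of_eight_lt (hκ : 8 < κ) :
    ∀ᵐ ω ∂Process.preWienerMeasure, upperHalfPlaneSet ⊆ closure (range (sleTrace κ ω)) :=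
  ae_subset_closure_range_sleTrace_of_hasSLETrace (hasSLETrace_of_ne_eight_holds hκ.ne') hκ.le

/-- **The named fact from `hasSLETrace_eight` alone**: with Thm 5.1 proved
(`hasSLETrace_of_ne_eight_holds`), the only remaining input of
`ae_infDist_sleTrace_eq_zero_of_eight_le` is that SLE₈ is generated by a curve
(`hasSLETrace_eight`, Lawler–Schramm–Werner (2004), Thm 4.7; hypothesis `h8`). This is the
discharge of the named fact up to that one theorem. [cite: RohdeSchramm2005, Lemma 6.3 and eq. (6.2)] -/
theorem ae_infDist_sleTrace_eq_zero_of_eight_le_of_hasSLETrace_eight (h8 : hasSLETrace_eight) :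
    ae_infDist_sleTrace_eq_zero_of_eight_le :=
  ae_infDist_sleTrace_eq_zero_of_eight_le_of_traceFacts h8 hasSLETrace_of_ne_eight_holds

/-- **`ae_infDist_sleTrace_eq_zero_of_eight_le ↔ hasSLETrace_eight`** over the proved tree: the
per-point density fact for `κ ≥ 8` (Rohde–Schramm (2005), Lemma 6.3 with eq. (6.2)) and "SLE₈ is
generated by a curve" (Lawler–Schramm–Werner (2004), Thm 4.7) are equivalent, everything else in
either direction being proved (`→`: the junk-trace observation at `κ = 8`; `←`: Lemma 6.3, (6.2)
and Thm 5.1). [cite: LawlerSchrammWerner2004, Thm 4.7] -/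
theorem ae_infDist_sleTrace_eq_zero_of_eight_le_iff_hasSLETrace_eight :
    ae_infDist_sleTrace_eq_zero_of_eight_le ↔ hasSLETrace_eight :=
  ⟨hasSLETrace_eight_of_ae_infDist_sleTrace_eq_zero_of_eight_le,
    ae_infDist_sleTrace_eq_zero_of_eight_le_of_hasSLETrace_eight⟩

end Literature.Probability.RandomPlanarGeometry

end
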